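import Literature.NumberTheory.DiophantineGeometry.GenEllFullGalois
import Literature.NumberTheory.DiophantineGeometry.GenEllMellReduction
import Literature.NumberTheory.DiophantineGeometry.GenEllMellExceptional
import Literature.NumberTheory.DiophantineGeometry.GenEllLemma37Core
import HarnessLib

/-!
# [GenEll] Lemma 3.7 (Finite Exceptional Sets) — PROOF modulo Lemma 3.5

Proof-only companion of `GenEllFullGalois.lean` (abc-iut campaign S; statement file typed by seat
abc-iut-S4; this file = DAG node `GenEll:Lem3.7`, seat abc-iut-S-d4).
S. Mochizuki, *Arithmetic elliptic curves in general position*, Math. J. Okayama Univ. **52** (2010)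
[cite: MochizukiGenEll2010], Lemma 3.7 and its proof, pp. 18–19 (quoted in `GenEllFullGalois.lean`).

## What is proved

* `lemma37_of_lemma35_on T` — for any class `T` of presented points: Lemma 3.5 **for the points of
  `T`** implies Lemma 3.7 **for the points of `T`** (same constants `C`, `Exc` for all of `T`).  This is
  the printed proof, assembled from: Prop. 3.4 (tree `prop34Ineq_of_pos`, at "`12(1+ε)` `=` `14`",
  i.e. `ε = 1/6`), Lemma 3.6 (tree `GenEll_lemma36`), Prop. 1.4 (iv) (tree `northcott_htInf`, through
  `mellExcGaloisFinite_htInfLe`), the first sentence "`d·deg_∞ ≥ v·log 2`"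
  (`EllPoint.localHeight_mul_log_two_le`), "`[E_L] ∈ K_V` bounds `ht_∞ − deg_∞`"
  (`MellCBData.exists_htInf_le_degInf_add`), "no multiplicative prime ⇒ `deg_∞ = 0`"
  (`EllPoint.degInf_eq_zero_of_not_hasMultPlace`), and the real-number cores `Lemma37.local_height_lt`,
  `Lemma37.htFalt_le`, `Lemma37.htInf_le` (`GenEllLemma37Core.lean`).  The exceptional set is
  `Exc = {minpoly_ℚ(j_E) : ht_∞([E]) ≤ B}` for an explicit bound `B = B(K_V, ε)`.
* `GenEll_lemma37_of_lemma35_general` — the named fact `GenEll_lemma37` BY NAME, from Lemma 3.5 in the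
  generality in which the printed proof of Lemma 3.7 invokes it (p. 18: "Thus, by Lemma 3.5, we
  conclude that `(l/14)·deg_∞([E_L]) ≤ ht_Falt([E_L]) + 2·log(l) + C′`" — for `E_L` over an ARBITRARY
  number field `L`).
* `GenEll_lemma37_on_totallyComplex_of_lemma35` — from the tree's named fact `GenEll_lemma35`, which
  carries [GenEll] §3's standing simplification "`F` totally imaginary" (p. 16), one gets Lemma 3.7 for
  the curves presented over totally complex fields (same statement, one more hypothesis).

HONEST STATUS.  `GenEll_lemma37` is therefore DISCHARGED MODULO "Lemma 3.5 without the totally-imaginary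
simplification"; closing the gap between that and the tree's `GenEll_lemma35` is the base change
`L ⊂ L(√−1)` (invariance of `ht_Falt`, `deg_∞`, of `l`-cyclic subgroup schemes and of semistability,
local heights multiplied by ramification indices `≤ 2`), which the tree does not yet provide for
`EllPoint`; it is NOT claimed here.  No statement of S4's file is touched; no definitions.
-/

noncomputable section

namespace Literature.NumberTheory.DiophantineGeometry.GenEll

open _root_.NumberField _root_.IsDedekindDomain
open scoped NumberField

/-- **[GenEll] Lemma 3.7 relative to a class `T` of presented points**: if the inequality of Lemma 3.5
(with its constant uniform in `E`, `F`, `H_F`, `l`) holds for the semistable points of `T`, then the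
three conclusions of Lemma 3.7 hold for the semistable points of `T`, with a constant `C > 0` and a
Galois-finite exceptional set `Exc` depending only on `K_V` and `ε`.  This is the printed proof
(pp. 18–19), verbatim up to the rendering conventions of `GenEllFullGalois.lean`; in case (b) the printed
shortcut "we may assume `l ≥ 5`" is replaced by an estimate valid for every prime.
[cite: MochizukiGenEll2010, Lem 3.7 p.18] -/
theorem lemma37_of_lemma35_on (T : EllPoint → Prop)
    (h35 : ∀ ε : ℝ, 0 < ε → ∃ C : ℝ, ∀ (P : EllPoint) (l : ℕ), l.Prime → T P → P.IsSemistable →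
      P.AdmitsLCyclic l →
      (∀ v : HeightOneSpectrum (𝓞 P.F), P.W.HasMultiplicativeReductionAt v →
        ¬ ((l : ℤ) ∣ P.localHeight v)) →
      (12 * (1 + ε))⁻¹ * l * P.degInf ≤ P.htFalt + 2 * Real.log l + C)
    (D : MellCBData) (ε : ℝ) (hε : 0 < ε) :
    ∃ C : ℝ, 0 < C ∧ ∃ Exc : Set (Polynomial ℚ), MellExcGaloisFinite Exc ∧
      ∀ (P : EllPoint) (l : ℕ), l.Prime → T P → P.IsSemistable →
        let condA : Prop :=
          100 * (P.degree : ℝ) * (P.htFalt + C * (P.degree : ℝ) ^ ε) ≤ l ∧ P.HasMultPlace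
        let condB : Prop := D.Mem P ∧
          ∀ v : HeightOneSpectrum (𝓞 P.F), P.W.HasMultiplicativeReductionAt v →
            ¬ ((l : ℤ) ∣ P.localHeight v)
        (condA → ∀ v : HeightOneSpectrum (𝓞 P.F), P.W.HasMultiplicativeReductionAt v →
          P.localHeight v < l) ∧
        (condB → ¬ MellExcMem Exc P → P.HasMultPlace) ∧
        ((condA ∨ condB) → P.AdmitsLCyclic l → MellExcMem Exc P) := by
  -- Prop. 3.4 at "`12(1+ε)` = 14", i.e. `ε = 1/6`
  obtain ⟨-, ⟨K', hK'⟩, ⟨K₂', hK₂'⟩⟩ := prop34Ineq_of_pos (by norm_num : (0 : ℝ) < 1 / 6)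
  set K : ℝ := max K' 0 with hKdef
  set K₂ : ℝ := max K₂' 0 with hK₂def
  have hK0 : 0 ≤ K := le_max_right _ _
  have hK₂0 : 0 ≤ K₂ := le_max_right _ _
  have h34mid : ∀ P : EllPoint, P.htInf ≤ 14 * P.htFalt + K := fun P => by
    have h := hK' P (Set.mem_univ _)
    have hK1 : K' ≤ K := le_max_left _ _
    norm_num at h
    linarith
  have h34right : ∀ P : EllPoint, 12 * (1 + 1 / 6) * P.htFalt ≤ (1 + 1 / 6) * P.htInf + K₂ :=
    fun P => by
    have h := hK₂' P (Set.mem_univ _)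
    have hK1 : K₂' ≤ K₂ := le_max_left _ _
    linarith
  -- Lemma 3.5 at `ε = 1/6`, Lemma 3.6 at `ε`, the `K_V`-bound
  obtain ⟨C', hC'⟩ := h35 (1 / 6) (by norm_num)
  obtain ⟨C₀, hC₀, h36⟩ := GenEll_lemma36 ε hε
  obtain ⟨A, hA0, hA⟩ := D.exists_htInf_le_degInf_add
  have hlog2 : 0 < Real.log 2 := Real.log_pos (by norm_num)
  -- the constant `C` and the bound `B`
  set C : ℝ := K / 14 + C₀ * (56 / Real.log 2) ^ (1 + ε) / 100 + 1 with hCdef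
  have hC56 : 0 ≤ C₀ * (56 / Real.log 2) ^ (1 + ε) := by positivity
  have hCpos : 0 < C := by
    have : 0 ≤ K / 14 := by positivity
    linarith
  have hCK : K / 14 ≤ C := by linarith
  have hCC : C₀ * (56 / Real.log 2) ^ (1 + ε) ≤ 100 * (C - K / 14) := by
    rw [hCdef]; ring_nf; linarith
  set Ba : ℝ := max 0 (C' / (100 * Real.log 2 / 28 - 1)) with hBa
  set Bb : ℝ := 168 / 5 * (max 0 (A / 12 + K₂ / 12 + C') / 2 + 2) + A with hBb
  set B : ℝ := max (14 * Ba + K) Bb with hB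
  have hBbA : A ≤ Bb := by
    have : 0 ≤ max 0 (A / 12 + K₂ / 12 + C') := le_max_left _ _
    rw [hBb]; nlinarith
  refine ⟨C, hCpos, {f | ∃ Q : EllPoint, minpoly ℚ Q.W.j = f ∧ Q.htInf ≤ B},
    mellExcGaloisFinite_htInfLe B, fun P l hl hT hss => ?_⟩
  -- the data of `P`
  have hd : (1 : ℝ) ≤ P.degree := by exact_mod_cast P.degree_pos
  have hd0 : (0 : ℝ) ≤ P.degree := by linarith
  have hdε : (1 : ℝ) ≤ (P.degree : ℝ) ^ ε := Real.one_le_rpow hd hε.le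
  have hl0 : (0 : ℝ) < l := by exact_mod_cast hl.pos
  have hl2 : (2 : ℝ) ≤ l := by exact_mod_cast hl.two_le
  have hDI : P.degInf ≤ P.htInf := P.degInf_le_htInf
  have hD0 : 0 ≤ P.degInf := P.degInf_nonneg
  have hDK : P.degInf ≤ 14 * P.htFalt + K := hDI.trans (h34mid P)
  -- (†) of Lemma 3.5 in the form `l/14 · deg_∞ ≤ ht_Falt + 2 log l + C'`
  have hdag : P.AdmitsLCyclic l →
      (∀ v : HeightOneSpectrum (𝓞 P.F), P.W.HasMultiplicativeReductionAt v →
        ¬ ((l : ℤ) ∣ P.localHeight v)) →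
      (l : ℝ) / 14 * P.degInf ≤ P.htFalt + 2 * Real.log l + C' := fun hcyc hcop => by
    have h := hC' P l hl hT hss hcyc hcop
    have e : (12 * (1 + 1 / 6 : ℝ))⁻¹ * l * P.degInf = (l : ℝ) / 14 * P.degInf := by ring
    linarith
  -- first conclusion: under (a), `l >` every local height at a multiplicative prime
  have hpart1 : 100 * (P.degree : ℝ) * (P.htFalt + C * (P.degree : ℝ) ^ ε) ≤ l →
      ∀ v : HeightOneSpectrum (𝓞 P.F), P.W.HasMultiplicativeReductionAt v →
        P.localHeight v < l := fun hlA v _ => by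
    have hv := P.localHeight_mul_log_two_le v
    have h := Lemma37.local_height_lt hK0 hCK hd hdε hDK hlA hl0 hv
    exact_mod_cast h
  refine ⟨fun hA => hpart1 hA.1, fun hBcond hnot => ?_, fun hAB hcyc => ?_⟩
  · -- second conclusion: under (b), outside `Exc` there is a multiplicative prime
    by_contra hno
    have h0 := P.degInf_eq_zero_of_not_hasMultPlace hss hno
    have h1 : P.htInf ≤ B := by
      have h2 := hA P hBcond.1
      rw [h0, zero_add] at h2
      exact h2.trans (hBbA.trans (le_max_right _ _))
    exact hnot (mellExcMem_htInfLe P h1)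
  · -- third conclusion: with an `l`-cyclic subgroup scheme, `[E_L] ∈ Exc`
    rcases hAB with ⟨hlA, hmult⟩ | ⟨hmem, hcop⟩
    · -- case (a)
      have hcop : ∀ v : HeightOneSpectrum (𝓞 P.F), P.W.HasMultiplicativeReductionAt v →
          ¬ ((l : ℤ) ∣ P.localHeight v) := fun v hv =>
        P.not_dvd_localHeight_of_lt v hv (hpart1 hlA v hv)
      have hlog := P.log_two_le_degree_mul_degInf_of_hasMultPlace hmult
      have hh : P.htFalt ≤ Ba :=
        Lemma37.htFalt_le hε hK0 hC₀ h36 hCK hCC hd hDK hD0 hlA (hdag hcyc hcop) hlog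
      refine mellExcMem_htInfLe P ?_
      calc P.htInf ≤ 14 * P.htFalt + K := h34mid P
        _ ≤ 14 * Ba + K := by linarith
        _ ≤ B := le_max_left _ _
    · -- case (b)
      have hh : P.htInf ≤ Bb :=
        Lemma37.htInf_le (by norm_num : (0 : ℝ) ≤ 1 / 6) hK₂0 hl2 hD0 (hA P hmem) (h34right P)
          (hdag hcyc hcop)
      exact mellExcMem_htInfLe P (hh.trans (le_max_right _ _))

/-- **`GenEll_lemma37` BY NAME, modulo Lemma 3.5 as invoked in its printed proof.**  The hypothesis is
[GenEll] Lemma 3.5 for semistable elliptic curves over ARBITRARY number fields — the form in which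
p. 18 applies it to `E_L` ("Thus, by Lemma 3.5, we conclude that (†)"); the tree's named fact
`GenEll_lemma35` is its case "`F` totally imaginary" ([GenEll] §3 standing simplification, p. 16), and
the reduction of the general case to that one (base change to `L(√−1)`) is not formalised here.
[cite: MochizukiGenEll2010, Lem 3.7 p.18] -/
theorem GenEll_lemma37_of_lemma35_general
    (h35 : ∀ ε : ℝ, 0 < ε → ∃ C : ℝ, ∀ (P : EllPoint) (l : ℕ), l.Prime → P.IsSemistable →
      P.AdmitsLCyclic l →
      (∀ v : HeightOneSpectrum (𝓞 P.F), P.W.HasMultiplicativeReductionAt v →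
        ¬ ((l : ℤ) ∣ P.localHeight v)) →
      (12 * (1 + ε))⁻¹ * l * P.degInf ≤ P.htFalt + 2 * Real.log l + C) :
    GenEll_lemma37 := by
  intro D ε hε
  obtain ⟨C, hC, Exc, hExc, hmain⟩ := lemma37_of_lemma35_on (fun _ => True)
    (fun ε' hε' => by
      obtain ⟨C, hC⟩ := h35 ε' hε'
      exact ⟨C, fun P l hl _ => hC P l hl⟩) D ε hε
  exact ⟨C, hC, Exc, hExc, fun P l hl hss => hmain P l hl trivial hss⟩

/-- **[GenEll] Lemma 3.7 for curves presented over totally complex fields, from the tree's named fact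
`GenEll_lemma35`** (which carries §3's standing hypothesis "`F` totally imaginary"): the statement of
`GenEll_lemma37` with the extra hypothesis `NumberField.IsTotallyComplex P.F`.
[cite: MochizukiGenEll2010, Lem 3.7 p.18] -/
theorem GenEll_lemma37_on_totallyComplex_of_lemma35 (h35 : GenEll_lemma35) (D : MellCBData)
    (ε : ℝ) (hε : 0 < ε) :
    ∃ C : ℝ, 0 < C ∧ ∃ Exc : Set (Polynomial ℚ), MellExcGaloisFinite Exc ∧
      ∀ (P : EllPoint) (l : ℕ), l.Prime → NumberField.IsTotallyComplex P.F → P.IsSemistable →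
        let condA : Prop :=
          100 * (P.degree : ℝ) * (P.htFalt + C * (P.degree : ℝ) ^ ε) ≤ l ∧ P.HasMultPlace
        let condB : Prop := D.Mem P ∧
          ∀ v : HeightOneSpectrum (𝓞 P.F), P.W.HasMultiplicativeReductionAt v →
            ¬ ((l : ℤ) ∣ P.localHeight v)
        (condA → ∀ v : HeightOneSpectrum (𝓞 P.F), P.W.HasMultiplicativeReductionAt v →
          P.localHeight v < l) ∧
        (condB → ¬ MellExcMem Exc P → P.HasMultPlace) ∧
        ((condA ∨ condB) → P.AdmitsLCyclic l → MellExcMem Exc P) :=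
  lemma37_of_lemma35_on (fun P => NumberField.IsTotallyComplex P.F)
    (fun ε' hε' => by
      obtain ⟨C, hC⟩ := h35 ε' hε'
      exact ⟨C, fun P l hl hT => hC P l hl hT⟩) D ε hε

end Literature.NumberTheory.DiophantineGeometry.GenEll

end
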